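import Summits.NavierStokesRegularity.NavierStokesRegularity.Theorems.RellichScarDefs
import Summits.NavierStokesRegularity.NavierStokesRegularity.Theorems.RellichScarScarRigidityApexRegularityExchange
import Summits.NavierStokesRegularity.NavierStokesRegularity.Theorems.RellichScarScarRigidityFarFieldAllOrders
import HarnessLib

/-!
# `ScarRigidity`, line `moment-conditioned-rellich` — stub `stub_vorticityDefectDecay` (V-rung), part 1:
# single-slice kinematics of the antisymmetric gradient

Crux stmt-NavierStokesRegularity-11717 (route RellichScar), helper file (`--supports`) for the registered stub
`stub_vorticityDefectDecay` (skeleton `Cruxes/ScarRigidity/Lines/moment_conditioned_rellich.lean`).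

For a field `f : ℝ³ → ℝ³` the ANTISYMMETRIC GRADIENT is `A_ij[f](y) = ∂ᵢf_j(y) − ∂ⱼf_i(y)`, written in the
skeleton as `(fderiv ℝ f y eᵢ) j − (fderiv ℝ f y eⱼ) i` with `eᵢ = EuclideanSpace.single i 1`.  This file is the
pointwise calculus of that expression:

* `A_ij[f] = R_ij ∘ Df` for the fixed continuous linear form `R_ij(M) = (M eᵢ)_j − (M eⱼ)_i` on `ℝ³ →L ℝ³`, of
  norm `≤ 2`; hence `A_ij[f]` is smooth and `‖Dᵏ A_ij[f](x)‖ ≤ 2 ‖Dᵏ⁺¹f(x)‖`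
  (`norm_iteratedFDeriv_antisymGrad_le`);
* linearity (`antisymGrad_sub_apply`) and `A_ij[∇π] = 0` for `π ∈ C²` (symmetry of the Hessian,
  `antisymGrad_gradient_eq_zero`) — the pressure drops out of `∂ₜA`;
* Leibniz bounds for the convective derivative `(u·∇)v = Dv(·)(u ·)` of two DIFFERENT fields
  (`norm_iteratedFDeriv_convect_le`) and their power-weighted form
  (`norm_iteratedFDeriv_convect_le_of_pow_bounds`: bounds `A/ρ^{p+b}`, `B/ρ^{q+1+b}` on the derivatives of
  `u`, `v` give `2ⁿAB/ρ^{p+q+1+n}`).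
-/

noncomputable section

open Set Filter Function MeasureTheory Metric TopologicalSpace
open scoped Topology ContDiff Laplacian InnerProductSpace RealInnerProductSpace
open Literature.Analysis.FluidPDE

set_option linter.dupNamespace false -- D-0017: `Summit.<S>.<S>.…` repeats the summit name by design

-- nested operator types (`(ℝ³ →L[ℝ] ℝ³) →L[ℝ] ℝ` composed with `ℝ³ [×k]→L[ℝ] (ℝ³ →L[ℝ] ℝ³)`)
set_option maxSynthPendingDepth 4

namespace Summit.NavierStokesRegularity.NavierStokesRegularity.Theorems.RellichScarScarRigidity

/-! ### The antisymmetric gradient as a fixed linear form of the derivative -/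

/-- **`A_ij[f] = R_ij ∘ Df`** for a fixed continuous linear form `R_ij(M) = (M eᵢ)_j − (M eⱼ)_i` on `ℝ³ →L[ℝ] ℝ³`
of norm `≤ 2` (each entry of `M` is bounded by `‖M‖`, and `‖eᵢ‖ = 1`). [folklore] -/
theorem exists_antisymGradForm (i j : Fin 3) :
    ∃ R : (EuclideanSpace ℝ (Fin 3) →L[ℝ] EuclideanSpace ℝ (Fin 3)) →L[ℝ] ℝ, ‖R‖ ≤ 2 ∧ ∀ f : EuclideanSpace ℝ (Fin 3) → EuclideanSpace ℝ (Fin 3),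
      (fun y => (fderiv ℝ f y (EuclideanSpace.single i (1 : ℝ))) j -
        (fderiv ℝ f y (EuclideanSpace.single j (1 : ℝ))) i) = R ∘ fderiv ℝ f := by
  refine ⟨ContinuousLinearMap.comp (EuclideanSpace.proj j)
      (ContinuousLinearMap.apply ℝ (EuclideanSpace ℝ (Fin 3)) (EuclideanSpace.single i (1 : ℝ))) -
    ContinuousLinearMap.comp (EuclideanSpace.proj i)
      (ContinuousLinearMap.apply ℝ (EuclideanSpace ℝ (Fin 3)) (EuclideanSpace.single j (1 : ℝ))), ?_, fun f => ?_⟩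
  · refine ContinuousLinearMap.opNorm_le_bound _ zero_le_two fun M => ?_
    have h1 : ∀ a b : Fin 3, ‖(M (EuclideanSpace.single a (1 : ℝ))) b‖ ≤ ‖M‖ := fun a b =>
      calc ‖(M (EuclideanSpace.single a (1 : ℝ))) b‖ ≤ ‖M (EuclideanSpace.single a (1 : ℝ))‖ :=
            PiLp.norm_apply_le _ _
        _ ≤ ‖M‖ * ‖(EuclideanSpace.single a (1 : ℝ) : EuclideanSpace ℝ (Fin 3))‖ := M.le_opNorm _
        _ = ‖M‖ := by simp
    have e : (ContinuousLinearMap.comp (EuclideanSpace.proj j)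
          (ContinuousLinearMap.apply ℝ (EuclideanSpace ℝ (Fin 3)) (EuclideanSpace.single i (1 : ℝ))) -
        ContinuousLinearMap.comp (EuclideanSpace.proj i)
          (ContinuousLinearMap.apply ℝ (EuclideanSpace ℝ (Fin 3)) (EuclideanSpace.single j (1 : ℝ)))) M =
        (M (EuclideanSpace.single i (1 : ℝ))) j - (M (EuclideanSpace.single j (1 : ℝ))) i := by simp
    rw [e]
    calc ‖(M (EuclideanSpace.single i (1 : ℝ))) j - (M (EuclideanSpace.single j (1 : ℝ))) i‖
        ≤ ‖(M (EuclideanSpace.single i (1 : ℝ))) j‖ + ‖(M (EuclideanSpace.single j (1 : ℝ))) i‖ := norm_sub_le _ _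
      _ ≤ ‖M‖ + ‖M‖ := add_le_add (h1 i j) (h1 j i)
      _ = 2 * ‖M‖ := by ring
  · funext y
    simp

/-- The antisymmetric gradient of a smooth field is smooth. [folklore] -/
theorem contDiff_antisymGrad {f : EuclideanSpace ℝ (Fin 3) → EuclideanSpace ℝ (Fin 3)} {n : ℕ∞} (hf : ContDiff ℝ (n + 1) f) (i j : Fin 3) :
    ContDiff ℝ n (fun y => (fderiv ℝ f y (EuclideanSpace.single i (1 : ℝ))) j -
      (fderiv ℝ f y (EuclideanSpace.single j (1 : ℝ))) i) := by
  obtain ⟨R, -, hR⟩ := exists_antisymGradForm i j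
  rw [hR f]
  exact R.contDiff.comp (hf.fderiv_right (m := n) le_rfl)

/-- **`‖Dᵏ A_ij[f](x)‖ ≤ 2 ‖Dᵏ⁺¹ f(x)‖`** for smooth `f`. [folklore] -/
theorem norm_iteratedFDeriv_antisymGrad_le {f : EuclideanSpace ℝ (Fin 3) → EuclideanSpace ℝ (Fin 3)} (hf : ContDiff ℝ ∞ f) (i j : Fin 3) (k : ℕ)
    (x : EuclideanSpace ℝ (Fin 3)) :
    ‖iteratedFDeriv ℝ k (fun y => (fderiv ℝ f y (EuclideanSpace.single i (1 : ℝ))) j -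
      (fderiv ℝ f y (EuclideanSpace.single j (1 : ℝ))) i) x‖ ≤ 2 * ‖iteratedFDeriv ℝ (k + 1) f x‖ := by
  obtain ⟨R, hR2, hR⟩ := exists_antisymGradForm i j
  rw [hR f]
  have hDf : ContDiff ℝ ∞ (fderiv ℝ f) := hf.fderiv_right (m := ∞) le_rfl
  calc ‖iteratedFDeriv ℝ k (R ∘ fderiv ℝ f) x‖ ≤ ‖R‖ * ‖iteratedFDeriv ℝ k (fderiv ℝ f) x‖ :=
        R.norm_iteratedFDeriv_comp_left hDf.contDiffAt (by exact_mod_cast le_top)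
    _ ≤ 2 * ‖iteratedFDeriv ℝ (k + 1) f x‖ := by
        rw [norm_iteratedFDeriv_fderiv]
        exact mul_le_mul_of_nonneg_right hR2 (norm_nonneg _)

/-- Linearity of the antisymmetric gradient at points of differentiability. [folklore] -/
theorem antisymGrad_sub_apply {f g : EuclideanSpace ℝ (Fin 3) → EuclideanSpace ℝ (Fin 3)} {y : EuclideanSpace ℝ (Fin 3)} (hf : DifferentiableAt ℝ f y)
    (hg : DifferentiableAt ℝ g y) (i j : Fin 3) :
    (fderiv ℝ (fun z => f z - g z) y (EuclideanSpace.single i (1 : ℝ))) j -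
        (fderiv ℝ (fun z => f z - g z) y (EuclideanSpace.single j (1 : ℝ))) i =
      ((fderiv ℝ f y (EuclideanSpace.single i (1 : ℝ))) j - (fderiv ℝ f y (EuclideanSpace.single j (1 : ℝ))) i) -
        ((fderiv ℝ g y (EuclideanSpace.single i (1 : ℝ))) j - (fderiv ℝ g y (EuclideanSpace.single j (1 : ℝ))) i) := by
  rw [fderiv_fun_sub hf hg]
  simp only [_root_.sub_apply, PiLp.sub_apply]
  ring

/-- Components of the derivative of a gradient are second derivatives:
`(D(∇π)(y) a)_j = D²π(y)(a)(eⱼ)`. [folklore] -/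
theorem fderiv_gradient_coord_eq_fderiv_fderiv {π : EuclideanSpace ℝ (Fin 3) → ℝ} (hπ : ContDiff ℝ 2 π) (y a : EuclideanSpace ℝ (Fin 3)) (j : Fin 3) :
    (fderiv ℝ (gradient π) y a) j = fderiv ℝ (fderiv ℝ π) y a (EuclideanSpace.single j (1 : ℝ)) := by
  have hD : HasFDerivAt (fderiv ℝ π) (fderiv ℝ (fderiv ℝ π) y) y :=
    ((hπ.fderiv_right (m := 1) le_rfl).differentiable one_ne_zero y).hasFDerivAt
  have hg : HasFDerivAt (gradient π)
      ((((InnerProductSpace.toDual ℝ (EuclideanSpace ℝ (Fin 3))).symm :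
        (EuclideanSpace ℝ (Fin 3) →L[ℝ] ℝ) →L[ℝ] EuclideanSpace ℝ (Fin 3))).comp (fderiv ℝ (fderiv ℝ π) y)) y :=
    (InnerProductSpace.toDual ℝ (EuclideanSpace ℝ (Fin 3))).symm.hasFDerivAt.comp y hD
  rw [hg.fderiv, ContinuousLinearMap.comp_apply]
  have h1 : ∀ v : EuclideanSpace ℝ (Fin 3), v j = ⟪v, (EuclideanSpace.single j (1 : ℝ) : EuclideanSpace ℝ (Fin 3))⟫ := fun v => by
    rw [EuclideanSpace.inner_single_right]; simp
  rw [h1]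
  simp [InnerProductSpace.toDual_symm_apply]

/-- **The antisymmetric gradient of a gradient vanishes**: `∂ᵢ∂ⱼπ = ∂ⱼ∂ᵢπ` for `π ∈ C²`. [folklore] -/
theorem antisymGrad_gradient_eq_zero {π : EuclideanSpace ℝ (Fin 3) → ℝ} (hπ : ContDiff ℝ 2 π) (y : EuclideanSpace ℝ (Fin 3)) (i j : Fin 3) :
    (fderiv ℝ (gradient π) y (EuclideanSpace.single i (1 : ℝ))) j -
      (fderiv ℝ (gradient π) y (EuclideanSpace.single j (1 : ℝ))) i = 0 := by
  rw [fderiv_gradient_coord_eq_fderiv_fderiv hπ, fderiv_gradient_coord_eq_fderiv_fderiv hπ, sub_eq_zero]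
  have hs : IsSymmSndFDerivAt ℝ π y :=
    hπ.contDiffAt.isSymmSndFDerivAt (by simp [minSmoothness_of_isRCLikeNormedField])
  exact hs _ _


/-! ### Leibniz bounds for the convective derivative of two fields -/

/-- **Leibniz bound for `(u·∇)v = Dv(·)(u ·)`**:
`‖Dⁿ((u·∇)v)(x)‖ ≤ Σₐ C(n,a) ‖Dᵃ⁺¹v(x)‖ ‖Dⁿ⁻ᵃu(x)‖` (Mathlib `norm_iteratedFDeriv_clm_apply`). [folklore] -/
theorem norm_iteratedFDeriv_convect_le {u v : EuclideanSpace ℝ (Fin 3) → EuclideanSpace ℝ (Fin 3)} (hu : ContDiff ℝ ∞ u) (hv : ContDiff ℝ ∞ v) (n : ℕ)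
    (x : EuclideanSpace ℝ (Fin 3)) :
    ‖iteratedFDeriv ℝ n (convect u v) x‖ ≤
      ∑ a ∈ Finset.range (n + 1), (n.choose a : ℝ) * ‖iteratedFDeriv ℝ (a + 1) v x‖ *
        ‖iteratedFDeriv ℝ (n - a) u x‖ := by
  have e : convect u v = fun y => (fderiv ℝ v y) (u y) := rfl
  have hDv : ContDiff ℝ ∞ (fderiv ℝ v) := hv.fderiv_right (m := ∞) le_rfl
  rw [e]
  refine (norm_iteratedFDeriv_clm_apply hDv hu x (by exact_mod_cast le_top)).trans (le_of_eq ?_)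
  refine Finset.sum_congr rfl fun a _ => ?_
  rw [norm_iteratedFDeriv_fderiv]

/-- The convective derivative of two smooth fields is smooth. [folklore] -/
theorem contDiff_convect {u v : EuclideanSpace ℝ (Fin 3) → EuclideanSpace ℝ (Fin 3)} (hu : ContDiff ℝ ∞ u) (hv : ContDiff ℝ ∞ v) :
    ContDiff ℝ ∞ (convect u v) := by
  have e : convect u v = fun y => (fderiv ℝ v y) (u y) := rfl
  rw [e]
  exact (hv.fderiv_right (m := ∞) le_rfl).clm_apply hu

/-- **Power-weighted Leibniz bound**: if `‖Dᵇu(x)‖ ≤ A/ρ^{p+b}` (`b ≤ n`) and `‖Dᵇv(x)‖ ≤ B/ρ^{q+b}`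
(`b ≤ n + 1`), then `‖Dⁿ((u·∇)v)(x)‖ ≤ 2ⁿ A B / ρ^{p+q+1+n}` (`Σₐ C(n,a) = 2ⁿ`). [folklore] -/
theorem norm_iteratedFDeriv_convect_le_of_pow_bounds {u v : EuclideanSpace ℝ (Fin 3) → EuclideanSpace ℝ (Fin 3)} (hu : ContDiff ℝ ∞ u)
    (hv : ContDiff ℝ ∞ v) {n p q : ℕ} {x : EuclideanSpace ℝ (Fin 3)} {ρ A B : ℝ} (hρ : 0 < ρ) (hB : 0 ≤ B)
    (hub : ∀ b ≤ n, ‖iteratedFDeriv ℝ b u x‖ ≤ A / ρ ^ (p + b))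
    (hvb : ∀ b ≤ n + 1, ‖iteratedFDeriv ℝ b v x‖ ≤ B / ρ ^ (q + b)) :
    ‖iteratedFDeriv ℝ n (convect u v) x‖ ≤ 2 ^ n * A * B / ρ ^ (p + q + 1 + n) := by
  calc ‖iteratedFDeriv ℝ n (convect u v) x‖
      ≤ ∑ a ∈ Finset.range (n + 1), (n.choose a : ℝ) * ‖iteratedFDeriv ℝ (a + 1) v x‖ *
          ‖iteratedFDeriv ℝ (n - a) u x‖ := norm_iteratedFDeriv_convect_le hu hv n x
    _ ≤ ∑ a ∈ Finset.range (n + 1), (n.choose a : ℝ) * (A * B / ρ ^ (p + q + 1 + n)) := by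
        refine Finset.sum_le_sum fun a ha => ?_
        have han : a ≤ n := Nat.lt_succ_iff.1 (Finset.mem_range.1 ha)
        have h1 := hvb (a + 1) (by omega)
        have h2 := hub (n - a) (Nat.sub_le n a)
        have hpow : ρ ^ (q + (a + 1)) * ρ ^ (p + (n - a)) = ρ ^ (p + q + 1 + n) := by
          rw [← pow_add]; congr 1; omega
        rw [mul_assoc]
        refine mul_le_mul_of_nonneg_left ?_ (Nat.cast_nonneg _)
        calc ‖iteratedFDeriv ℝ (a + 1) v x‖ * ‖iteratedFDeriv ℝ (n - a) u x‖
            ≤ (B / ρ ^ (q + (a + 1))) * (A / ρ ^ (p + (n - a))) :=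
              mul_le_mul h1 h2 (norm_nonneg _) (div_nonneg hB (pow_nonneg hρ.le _))
          _ = A * B / ρ ^ (p + q + 1 + n) := by
              rw [div_mul_div_comm, hpow]; ring
    _ = 2 ^ n * A * B / ρ ^ (p + q + 1 + n) := by
        rw [← Finset.sum_mul]
        have h' : (∑ a ∈ Finset.range (n + 1), (n.choose a : ℝ)) = 2 ^ n := by
          exact_mod_cast Nat.sum_range_choose n
        rw [h']; ring

/-! ### The defect source `G = Δw − ((w·∇)V₁ + (V₂·∇)w)` -/

/-- The defect source of three smooth fields is smooth. [folklore] -/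
theorem contDiff_defectSource {w V₁ V₂ : EuclideanSpace ℝ (Fin 3) → EuclideanSpace ℝ (Fin 3)} (hw : ContDiff ℝ ∞ w) (hV₁ : ContDiff ℝ ∞ V₁)
    (hV₂ : ContDiff ℝ ∞ V₂) :
    ContDiff ℝ ∞ (fun y => Δ w y - (convect w V₁ y + convect V₂ w y)) :=
  (contDiff_laplacian (n := ⊤) (by exact_mod_cast hw)).sub
    ((contDiff_convect hw hV₁).add (contDiff_convect hV₂ hw))

/-- **Pointwise bound for all derivatives of the defect source.**  If at `x` the derivatives of `w` obey
`‖Dᵇw‖ ≤ A/ρ^{p+b}` (`b ≤ n + 2`) and those of `V₁`, `V₂` obey `‖DᵇVᵢ‖ ≤ B/ρ^{1+b}` (`b ≤ n + 1`), then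
`‖Dⁿ(Δw − ((w·∇)V₁ + (V₂·∇)w))(x)‖ ≤ (3 + 2ⁿ⁺¹B) A / ρ^{p+2+n}` (`‖DⁿΔw‖ ≤ 3‖Dⁿ⁺²w‖` and the two
Leibniz bounds). [folklore] -/
theorem norm_iteratedFDeriv_defectSource_le {w V₁ V₂ : EuclideanSpace ℝ (Fin 3) → EuclideanSpace ℝ (Fin 3)} (hw : ContDiff ℝ ∞ w)
    (hV₁ : ContDiff ℝ ∞ V₁) (hV₂ : ContDiff ℝ ∞ V₂) {n p : ℕ} {x : EuclideanSpace ℝ (Fin 3)} {ρ A B : ℝ} (hρ : 0 < ρ)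
    (hA : 0 ≤ A) (hB : 0 ≤ B)
    (hwb : ∀ b ≤ n + 2, ‖iteratedFDeriv ℝ b w x‖ ≤ A / ρ ^ (p + b))
    (hV₁b : ∀ b ≤ n + 1, ‖iteratedFDeriv ℝ b V₁ x‖ ≤ B / ρ ^ (1 + b))
    (hV₂b : ∀ b ≤ n + 1, ‖iteratedFDeriv ℝ b V₂ x‖ ≤ B / ρ ^ (1 + b)) :
    ‖iteratedFDeriv ℝ n (fun y => Δ w y - (convect w V₁ y + convect V₂ w y)) x‖ ≤
      (3 + 2 ^ (n + 1) * B) * A / ρ ^ (p + 2 + n) := by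
  have hΔ : ContDiff ℝ ∞ (Δ w) := contDiff_laplacian (n := ⊤) (by exact_mod_cast hw)
  have hc₁ : ContDiff ℝ ∞ (convect w V₁) := contDiff_convect hw hV₁
  have hc₂ : ContDiff ℝ ∞ (convect V₂ w) := contDiff_convect hV₂ hw
  have hn : ((n : ℕ∞) : WithTop ℕ∞) ≤ ∞ := by exact_mod_cast le_top
  have e1 : iteratedFDeriv ℝ n (fun y => Δ w y - (convect w V₁ y + convect V₂ w y)) x =
      iteratedFDeriv ℝ n (Δ w) x - (iteratedFDeriv ℝ n (convect w V₁) x + iteratedFDeriv ℝ n (convect V₂ w) x) := by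
    rw [fun_iteratedFDeriv_sub_apply (hΔ.of_le hn).contDiffAt ((hc₁.add hc₂).of_le hn).contDiffAt,
      fun_iteratedFDeriv_add_apply (hc₁.of_le hn).contDiffAt (hc₂.of_le hn).contDiffAt]
  -- the three bounds
  have hwn : ContDiff ℝ (n + 2 : ℕ) w := contDiff_infty.1 hw (n + 2)
  have b1 : ‖iteratedFDeriv ℝ n (Δ w) x‖ ≤ 3 * (A / ρ ^ (p + 2 + n)) := by
    refine (norm_iteratedFDeriv_laplacian_le_three_mul hwn x).trans ?_
    refine mul_le_mul_of_nonneg_left ?_ (by norm_num)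
    have := hwb (n + 2) le_rfl
    rwa [show p + (n + 2) = p + 2 + n by ring] at this
  have b2 : ‖iteratedFDeriv ℝ n (convect w V₁) x‖ ≤ 2 ^ n * A * B / ρ ^ (p + 1 + 1 + n) :=
    norm_iteratedFDeriv_convect_le_of_pow_bounds hw hV₁ hρ hB (fun b hb => hwb b (by omega)) hV₁b
  have b3 : ‖iteratedFDeriv ℝ n (convect V₂ w) x‖ ≤ 2 ^ n * B * A / ρ ^ (1 + p + 1 + n) :=
    norm_iteratedFDeriv_convect_le_of_pow_bounds hV₂ hw hρ hA (fun b hb => hV₂b b (by omega))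
      (fun b hb => hwb b (by omega))
  rw [e1]
  have e2 : p + 1 + 1 + n = p + 2 + n := by ring
  have e3 : 1 + p + 1 + n = p + 2 + n := by ring
  rw [e2] at b2
  rw [e3] at b3
  calc ‖iteratedFDeriv ℝ n (Δ w) x - (iteratedFDeriv ℝ n (convect w V₁) x + iteratedFDeriv ℝ n (convect V₂ w) x)‖
      ≤ ‖iteratedFDeriv ℝ n (Δ w) x‖ +
          (‖iteratedFDeriv ℝ n (convect w V₁) x‖ + ‖iteratedFDeriv ℝ n (convect V₂ w) x‖) :=
        (norm_sub_le _ _).trans (add_le_add le_rfl (norm_add_le _ _))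
    _ ≤ 3 * (A / ρ ^ (p + 2 + n)) + (2 ^ n * A * B / ρ ^ (p + 2 + n) + 2 ^ n * B * A / ρ ^ (p + 2 + n)) :=
        add_le_add b1 (add_le_add b2 b3)
    _ = (3 + 2 ^ (n + 1) * B) * A / ρ ^ (p + 2 + n) := by ring

/-! ### Uniform constants up to a finite order -/

/-- From order-wise constants to ONE constant for all orders `b ≤ N` (and made nonnegative), for any family
of properties monotone in the constant. [folklore] -/
theorem exists_forall_le_of_forall_exists {P : ℕ → ℝ → Prop}
    (hmono : ∀ n L L', L ≤ L' → P n L → P n L') (h : ∀ n, ∃ L, P n L) (N : ℕ) :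
    ∃ L, 0 ≤ L ∧ ∀ b ≤ N, P b L := by
  induction N with
  | zero =>
    obtain ⟨L, hL⟩ := h 0
    refine ⟨max L 0, le_max_right _ _, fun b hb => ?_⟩
    rw [Nat.le_zero.1 hb]
    exact hmono 0 L _ (le_max_left _ _) hL
  | succ N ih =>
    obtain ⟨L₀, hL₀, hP₀⟩ := ih
    obtain ⟨L₁, hL₁⟩ := h (N + 1)
    refine ⟨L₀ + max L₁ 0, add_nonneg hL₀ (le_max_right _ _), fun b hb => ?_⟩
    rcases Nat.lt_or_ge b (N + 1) with hb' | hb'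
    · exact hmono b L₀ _ (le_add_of_nonneg_right (le_max_right _ _)) (hP₀ b (Nat.lt_succ_iff.1 hb'))
    · rw [le_antisymm hb hb']
      exact hmono _ L₁ _ ((le_max_left _ _).trans (le_add_of_nonneg_left hL₀)) hL₁

/-- **The scale-invariant package with one constant for all orders `b ≤ N`.** [folklore] -/
theorem scaleInvariantBounds_uniform {V : ℝ → EuclideanSpace ℝ (Fin 3) → EuclideanSpace ℝ (Fin 3)}
    {Q : ℝ → EuclideanSpace ℝ (Fin 3) → ℝ} (h : ScaleInvariantBounds V Q)
    (N : ℕ) :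
    ∃ L : ℝ, 0 ≤ L ∧ ∀ b ≤ N, ∀ t < 0, ∀ x : EuclideanSpace ℝ (Fin 3),
      ‖iteratedFDeriv ℝ b (V t) x‖ ≤ L / (‖x‖ + Real.sqrt (-t)) ^ (1 + b) ∧
        ‖iteratedFDeriv ℝ b (Q t) x‖ ≤ L / (‖x‖ + Real.sqrt (-t)) ^ (2 + b) ∧
          ‖deriv (fun s => iteratedFDeriv ℝ b (V s) x) t‖ ≤ L / (‖x‖ + Real.sqrt (-t)) ^ (3 + b) := by
  refine exists_forall_le_of_forall_exists (P := fun b L => ∀ t < 0, ∀ x : EuclideanSpace ℝ (Fin 3),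
      ‖iteratedFDeriv ℝ b (V t) x‖ ≤ L / (‖x‖ + Real.sqrt (-t)) ^ (1 + b) ∧
        ‖iteratedFDeriv ℝ b (Q t) x‖ ≤ L / (‖x‖ + Real.sqrt (-t)) ^ (2 + b) ∧
          ‖deriv (fun s => iteratedFDeriv ℝ b (V s) x) t‖ ≤ L / (‖x‖ + Real.sqrt (-t)) ^ (3 + b))
    (fun n L L' hLL' hP t ht x => ?_) h N
  obtain ⟨h1, h2, h3⟩ := hP t ht x
  have hρ : 0 ≤ ‖x‖ + Real.sqrt (-t) := by positivity
  exact ⟨h1.trans (div_le_div_of_nonneg_right hLL' (pow_nonneg hρ _)),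
    h2.trans (div_le_div_of_nonneg_right hLL' (pow_nonneg hρ _)),
    h3.trans (div_le_div_of_nonneg_right hLL' (pow_nonneg hρ _))⟩

/-- **Cubic flatness with one constant for all orders `b ≤ N`**, in the form `K(−t)/‖x‖^{3+b}` on the parabolic
exterior (`(√(−t))⁻¹(√(−t)/‖x‖)³/‖x‖ᵇ = (−t)/‖x‖^{3+b}`, `farDecay_three_algebra`). [folklore] -/
theorem farDecay_three_uniform {V₁ V₂ : ℝ → EuclideanSpace ℝ (Fin 3) → EuclideanSpace ℝ (Fin 3)} (h : FarDecay 3 V₁ V₂) (N : ℕ) :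
    ∃ K : ℝ, 0 ≤ K ∧ ∀ b ≤ N, ∀ t < 0, ∀ x : EuclideanSpace ℝ (Fin 3), Real.sqrt (-t) ≤ ‖x‖ →
      ‖iteratedFDeriv ℝ b (fun y => V₁ t y - V₂ t y) x‖ ≤ K * (-t) / ‖x‖ ^ (3 + b) := by
  refine exists_forall_le_of_forall_exists (P := fun b K => ∀ t < 0, ∀ x : EuclideanSpace ℝ (Fin 3), Real.sqrt (-t) ≤ ‖x‖ →
      ‖iteratedFDeriv ℝ b (fun y => V₁ t y - V₂ t y) x‖ ≤ K * (-t) / ‖x‖ ^ (3 + b))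
    (fun n K K' hKK' hP t ht x hx => ?_) (fun n => ?_) N
  · have hσ : 0 < Real.sqrt (-t) := Real.sqrt_pos.2 (by linarith)
    have hxpos : 0 < ‖x‖ := hσ.trans_le hx
    refine (hP t ht x hx).trans (div_le_div_of_nonneg_right ?_ (pow_nonneg hxpos.le _))
    exact mul_le_mul_of_nonneg_right hKK' (by linarith)
  · obtain ⟨K, hK⟩ := h n
    refine ⟨K, fun t ht x hx => ?_⟩
    have hσ : 0 < Real.sqrt (-t) := Real.sqrt_pos.2 (by linarith)
    have hxpos : 0 < ‖x‖ := hσ.trans_le hx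
    have h3 := farDecay_three_algebra K hσ hxpos n
    rw [Real.sq_sqrt (by linarith)] at h3
    rw [show K * (-t) / ‖x‖ ^ (3 + n) = K / ‖x‖ ^ (3 + n) * (-t) by ring, h3]
    exact hK t ht x hx

/-- **Global cubic flatness.**  Under the scale-invariant packages, cubic flatness on the parabolic exterior
extends to the WHOLE slab in the form `‖Dᵇ(V₁ − V₂)(t,x)‖ ≤ W(−t)/(‖x‖+√(−t))^{3+b}` (`b ≤ N`, one constant):
on the exterior `‖x‖+√(−t) ≤ 2‖x‖`, in the core `‖DᵇVᵢ‖ ≤ Lᵢ/(‖x‖+√(−t))^{1+b}` and `(‖x‖+√(−t))² ≤ 4(−t)`.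
[folklore] -/
theorem exists_global_cubic_flatness {V₁ V₂ : ℝ → EuclideanSpace ℝ (Fin 3) → EuclideanSpace ℝ (Fin 3)} {Q₁ Q₂ : ℝ → EuclideanSpace ℝ (Fin 3) → ℝ}
    (hV₁ : IsSmoothSpaceTimeOn (Iio (0 : ℝ)) V₁) (hV₂ : IsSmoothSpaceTimeOn (Iio (0 : ℝ)) V₂)
    (hB₁ : ScaleInvariantBounds V₁ Q₁) (hB₂ : ScaleInvariantBounds V₂ Q₂) (hF : FarDecay 3 V₁ V₂) (N : ℕ) :
    ∃ W : ℝ, 0 ≤ W ∧ ∀ b ≤ N, ∀ t < 0, ∀ x : EuclideanSpace ℝ (Fin 3),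
      ‖iteratedFDeriv ℝ b (fun y => V₁ t y - V₂ t y) x‖ ≤ W * (-t) / (‖x‖ + Real.sqrt (-t)) ^ (3 + b) := by
  obtain ⟨L₁, hL₁0, hL₁⟩ := scaleInvariantBounds_uniform hB₁ N
  obtain ⟨L₂, hL₂0, hL₂⟩ := scaleInvariantBounds_uniform hB₂ N
  obtain ⟨K, hK0, hK⟩ := farDecay_three_uniform hF N
  refine ⟨2 ^ (3 + N) * K + 4 * (L₁ + L₂), by positivity, fun b hb t ht x => ?_⟩
  have hσ : 0 < Real.sqrt (-t) := Real.sqrt_pos.2 (by linarith)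
  have hnt : 0 < -t := by linarith
  set ρ : ℝ := ‖x‖ + Real.sqrt (-t) with hρ
  have hρ0 : 0 < ρ := by positivity
  have hρb : 0 < ρ ^ (3 + b) := pow_pos hρ0 _
  rcases le_or_gt (Real.sqrt (-t)) ‖x‖ with hx | hx
  · -- exterior
    have hxpos : 0 < ‖x‖ := hσ.trans_le hx
    have h1 := hK b hb t ht x hx
    have hρx : ρ ≤ 2 * ‖x‖ := by rw [hρ]; linarith
    have hpow : ρ ^ (3 + b) ≤ 2 ^ (3 + N) * ‖x‖ ^ (3 + b) :=
      calc ρ ^ (3 + b) ≤ (2 * ‖x‖) ^ (3 + b) := pow_le_pow_left₀ hρ0.le hρx _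
        _ = 2 ^ (3 + b) * ‖x‖ ^ (3 + b) := mul_pow _ _ _
        _ ≤ 2 ^ (3 + N) * ‖x‖ ^ (3 + b) :=
            mul_le_mul_of_nonneg_right (pow_le_pow_right₀ one_le_two (by omega)) (pow_nonneg hxpos.le _)
    calc ‖iteratedFDeriv ℝ b (fun y => V₁ t y - V₂ t y) x‖ ≤ K * (-t) / ‖x‖ ^ (3 + b) := h1
      _ ≤ 2 ^ (3 + N) * K * (-t) / ρ ^ (3 + b) := by
          rw [div_le_div_iff₀ (pow_pos hxpos _) hρb]
          calc K * (-t) * ρ ^ (3 + b) ≤ K * (-t) * (2 ^ (3 + N) * ‖x‖ ^ (3 + b)) :=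
                mul_le_mul_of_nonneg_left hpow (by positivity)
            _ = 2 ^ (3 + N) * K * (-t) * ‖x‖ ^ (3 + b) := by ring
      _ ≤ (2 ^ (3 + N) * K + 4 * (L₁ + L₂)) * (-t) / ρ ^ (3 + b) := by
          refine div_le_div_of_nonneg_right (mul_le_mul_of_nonneg_right ?_ hnt.le) hρb.le
          linarith [mul_nonneg (show (0 : ℝ) ≤ 4 by norm_num) (add_nonneg hL₁0 hL₂0)]
  · -- core
    have h1 := (hL₁ b hb t ht x).1
    have h2 := (hL₂ b hb t ht x).1
    have hρσ : ρ ^ 2 ≤ 4 * (-t) := by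
      have : ρ ≤ 2 * Real.sqrt (-t) := by rw [hρ]; linarith
      calc ρ ^ 2 ≤ (2 * Real.sqrt (-t)) ^ 2 := pow_le_pow_left₀ hρ0.le this 2
        _ = 4 * (-t) := by rw [mul_pow, Real.sq_sqrt hnt.le]; norm_num
    rw [iteratedFDeriv_sub_slice hV₁ hV₂ b ht x]
    calc ‖iteratedFDeriv ℝ b (V₁ t) x - iteratedFDeriv ℝ b (V₂ t) x‖
        ≤ ‖iteratedFDeriv ℝ b (V₁ t) x‖ + ‖iteratedFDeriv ℝ b (V₂ t) x‖ := norm_sub_le _ _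
      _ ≤ L₁ / ρ ^ (1 + b) + L₂ / ρ ^ (1 + b) := add_le_add h1 h2
      _ = (L₁ + L₂) * ρ ^ 2 / ρ ^ (3 + b) := by
          rw [← add_div, div_eq_div_iff (pow_pos hρ0 _).ne' hρb.ne', pow_add, pow_add]
          ring
      _ ≤ (L₁ + L₂) * (4 * (-t)) / ρ ^ (3 + b) :=
          div_le_div_of_nonneg_right (mul_le_mul_of_nonneg_left hρσ (add_nonneg hL₁0 hL₂0)) hρb.le
      _ ≤ (2 ^ (3 + N) * K + 4 * (L₁ + L₂)) * (-t) / ρ ^ (3 + b) := by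
          refine div_le_div_of_nonneg_right ?_ hρb.le
          nlinarith [mul_nonneg (pow_nonneg (zero_le_two (α := ℝ)) (3 + N)) hK0]

/-- **The velocity packages of the twins with one constant**: `‖DᵇVᵢ(t,x)‖ ≤ L/(‖x‖+√(−t))^{1+b}` for
`b ≤ N`, `i = 1, 2`. [folklore] -/
theorem exists_twin_velocity_bounds {V₁ V₂ : ℝ → EuclideanSpace ℝ (Fin 3) → EuclideanSpace ℝ (Fin 3)} {Q₁ Q₂ : ℝ → EuclideanSpace ℝ (Fin 3) → ℝ}
    (hB₁ : ScaleInvariantBounds V₁ Q₁) (hB₂ : ScaleInvariantBounds V₂ Q₂) (N : ℕ) :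
    ∃ L : ℝ, 0 ≤ L ∧ ∀ b ≤ N, ∀ t < 0, ∀ x : EuclideanSpace ℝ (Fin 3),
      ‖iteratedFDeriv ℝ b (V₁ t) x‖ ≤ L / (‖x‖ + Real.sqrt (-t)) ^ (1 + b) ∧
        ‖iteratedFDeriv ℝ b (V₂ t) x‖ ≤ L / (‖x‖ + Real.sqrt (-t)) ^ (1 + b) := by
  obtain ⟨L₁, hL₁0, hL₁⟩ := scaleInvariantBounds_uniform hB₁ N
  obtain ⟨L₂, hL₂0, hL₂⟩ := scaleInvariantBounds_uniform hB₂ N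
  refine ⟨L₁ + L₂, add_nonneg hL₁0 hL₂0, fun b hb t ht x => ?_⟩
  have hρ : 0 ≤ (‖x‖ + Real.sqrt (-t)) ^ (1 + b) := by positivity
  exact ⟨(hL₁ b hb t ht x).1.trans (div_le_div_of_nonneg_right (le_add_of_nonneg_right hL₂0) hρ),
    (hL₂ b hb t ht x).1.trans (div_le_div_of_nonneg_right (le_add_of_nonneg_left hL₁0) hρ)⟩

/-! ### Registered sub-goal -/

/-- **Registered helper stub `stub_vorticityDefectKinematicsTools`** of `stub_vorticityDefectDecay` (crux
stmt-NavierStokesRegularity-11717, line `moment-conditioned-rellich`): the kinematic tools of this file —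
`‖DᵏA_ij[f]‖ ≤ 2‖Dᵏ⁺¹f‖`, `A_ij[∇π] = 0`, and global cubic flatness of the twin difference. [folklore] -/
theorem stub_vorticityDefectKinematicsTools :
    (∀ (f : EuclideanSpace ℝ (Fin 3) → EuclideanSpace ℝ (Fin 3)), ContDiff ℝ (⊤ : ℕ∞) f →
      ∀ (i j : Fin 3) (k : ℕ) (x : EuclideanSpace ℝ (Fin 3)),
        ‖iteratedFDeriv ℝ k (fun y => (fderiv ℝ f y (EuclideanSpace.single i (1 : ℝ))) j -
          (fderiv ℝ f y (EuclideanSpace.single j (1 : ℝ))) i) x‖ ≤ 2 * ‖iteratedFDeriv ℝ (k + 1) f x‖) ∧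
    (∀ (π : EuclideanSpace ℝ (Fin 3) → ℝ), ContDiff ℝ 2 π → ∀ (y : EuclideanSpace ℝ (Fin 3)) (i j : Fin 3),
      (fderiv ℝ (gradient π) y (EuclideanSpace.single i (1 : ℝ))) j -
        (fderiv ℝ (gradient π) y (EuclideanSpace.single j (1 : ℝ))) i = 0) ∧
    (∀ (V₁ V₂ : ℝ → EuclideanSpace ℝ (Fin 3) → EuclideanSpace ℝ (Fin 3))
      (Q₁ Q₂ : ℝ → EuclideanSpace ℝ (Fin 3) → ℝ),
      IsSmoothSpaceTimeOn (Iio (0 : ℝ)) V₁ → IsSmoothSpaceTimeOn (Iio (0 : ℝ)) V₂ →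
      ScaleInvariantBounds V₁ Q₁ → ScaleInvariantBounds V₂ Q₂ → FarDecay 3 V₁ V₂ → ∀ N : ℕ,
      ∃ W : ℝ, 0 ≤ W ∧ ∀ b ≤ N, ∀ t < 0, ∀ x : EuclideanSpace ℝ (Fin 3),
        ‖iteratedFDeriv ℝ b (fun y => V₁ t y - V₂ t y) x‖ ≤ W * (-t) / (‖x‖ + Real.sqrt (-t)) ^ (3 + b)) :=
  ⟨fun _f hf i j k x => norm_iteratedFDeriv_antisymGrad_le hf i j k x,
    fun _π hπ y i j => antisymGrad_gradient_eq_zero hπ y i j,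
    fun _V₁ _V₂ _Q₁ _Q₂ hV₁ hV₂ hB₁ hB₂ hF N => exists_global_cubic_flatness hV₁ hV₂ hB₁ hB₂ hF N⟩

end Summit.NavierStokesRegularity.NavierStokesRegularity.Theorems.RellichScarScarRigidity

end
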